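import Summits.ABC.IUTFork.Joshi.ATS4DescentInputsCalibration
import Mathlib.Analysis.Complex.ExponentialBounds
import HarnessLib

/-!
# [J-IV] (arXiv:2403.10430v2) §5.8 / §6 ⟶ §7: WHERE the calibrated descent inequality (E) of the E5 spine has content —
# automatic at every Thm-6.1.1 datum of normalised height `log q ≤ 8.69·10¹⁴` inside Lemma 5.8.7's window `√(log q) ≤ ℓ`,
# and FALSE at an explicit window-respecting datum of height `9·10¹⁴`

Proof-only companion (0 defs) of the abc-iut cell, branch E / R-J «Joshi Y-discharge census» (rung LADDER-ABC:A2.RESCUE.J; D-0079),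
seat abc-iut-E-t6 (gen 6); quantitative rider I2 of this seat's RQ7 read of abc-iut-E-t21's `Joshi/ATS4DescentInputsEssentiality.lean`
(p451846) for the Y-21 JOINT row of `HOME/plan/E/R-J/Y-CENSUS.tsv`. Parents BUILT, every input BY NAME: abc-iut-E-t35's calibration
`MainBoundDatum.exists_glue_inputs_iff` (p446138, `Joshi/ATS4DescentInputsCalibration.lean`: on the free glued carrier the nine named
§6.8–§6.11 inputs are jointly satisfiable iff ONE explicit inequality (E) holds at the Thm-6.1.1 datum `M : MainBoundDatum`), consumed
by abc-iut-E-t30's `abc_of_thetaDivisionIneq` (p447881) at the genuine theta datum and for EVERY prime `ℓ` of Lemma 5.8.7 at the point.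
SOURCE: K. Joshi, *Construction of Arithmetic Teichmüller Spaces IV*, arXiv:2403.10430v2 (unrefereed; bib `Joshi2024ATS4`): Lemma 5.8.7
p.56 l.33–42, window sentence l.35–36 («a prime ℓ with Q^{1/2} ≤ ℓ ≤ 10·δ·Q^{1/2}·log(2·δ·Q)», `δ = 2¹²·3³·5·d`; locator corrected in v2 after abc-iut-E-t21's audit of p454071 — v1 printed «p.55 l.37», which is Lemma 5.8.2's proof), Thm. 6.1.1 p.58 l.1–23, Thm. 6.10.1
p.66 l.12–61; page/line = the cell's render `HOME/lit/renders/Joshi-arxiv-2403.10430/`.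

FRAMING (binding): real arithmetic over the typed SIGNATURE `MainBoundDatum` (nothing of the arithmetic of any curve); a statement
about OUR typing of a third party's unrefereed text. NO side is taken on [IUTchIII] Cor. 3.12 / [IUTchIV] Thm. 1.10, on Joshi's claims,
or on Mochizuki's report on them; NOT a test verdict; NO abc claim. Typed ≠ proved ≠ endorsed.

WHAT IS PROVED (numbers, not adjectives).
1. `MainBoundDatum.ineqE_of_logq_le_sq_ell` — for EVERY Thm-6.1.1 datum with `log q ≤ ℓ²` (the lower end `Q^{1/2} ≤ ℓ` of Lemma
   5.8.7's window, read on `log q`) and `log q ≤ 869·10¹²`, (E) HOLDS: its right side is `≥ (80/9)·e*_mod·ℓ ≥ (80/9)·552960·ℓ` while its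
   left side is `≤ log q/6`, and `log q/6 ≤ (80/9)·552960·ℓ` as soon as `log q ≤ min(ℓ², 29491200·ℓ)`. So at every λ-line point of
   normalised height `≤ 8.69·10¹⁴` the residual (E)@ofGenuine of the E5 spine (E-t21's «OPEN only as (E)@ofGenuine») is AUTOMATIC —
   the antecedent of `abc_of_thetaDivisionIneq` has content only at heights `log q > 8.69·10¹⁴`.
2. `MainBoundDatum.exists_window_not_ineqE` — the content is NON-VOID INSIDE THE WINDOW: the explicit datum `ℓ = 30000001` (prime),
   `d_mod = e_mod = 1`, all log-degrees `0`, `log q = 9·10¹⁴` satisfies `7 ≤ ℓ`, `log q ≤ ℓ²` AND the window's upper end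
   `ℓ ≤ 10·552960·√(log q)·log(2·552960·log q)` (`δ` at `d = 1`), and (E) FAILS there (`LHS ≈ 1.5·10¹⁴ − 2 > RHS ≈ 1.4746·10¹⁴ + 120`).
   Compare p451846's `exists_mainBoundDatum_not_ineqE` (`ℓ = 5`, `log q = 10⁹`), which lies BELOW the window (`ℓ < √(log q)`).
Reading of `Q`: the window of Lemma 5.8.7 is stated on `Q = Cor22.logQForall λ`; at the genuine theta datum `M.logq = logQAvoid λ {2,ℓ}
≤ logQForall λ` (E-t30's `thetaTower_logq_eq`), so `√(M.logq) ≤ √Q ≤ ℓ` — the hypothesis `log q ≤ ℓ²` of (1) is implied by the window.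
Theorems only (2); standard axioms; no `sorry`, instance, notation, `def` or new `Prop`. [claim: Joshi2024ATS4, status: disputed] for
the locators.
-/

noncomputable section

namespace Summit.ABC.IUTFork.Joshi.ATS4

namespace MainBoundDatum

variable (M : MainBoundDatum)

/-- **(E) is AUTOMATIC at small height inside the window.** For every Thm-6.1.1 datum `M` with `log q ≤ ℓ²` (Lemma 5.8.7's
`Q^{1/2} ≤ ℓ` read on `log q`, p.56 l.35–36) and `log q ≤ 869·10¹²`, the calibrated inequality (E) of
`MainBoundDatum.exists_glue_inputs_iff` (p446138) holds: `LHS ≤ log q/6 ≤ (80/9)·552960·ℓ ≤ (80/9)·e*_mod·ℓ ≤ RHS` (every other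
right-hand term is `≥ 0`). Real arithmetic over the signature. [claim: Joshi2024ATS4, status: disputed] (locators); [folklore] (the bound). -/
theorem ineqE_of_logq_le_sq_ell (hw : M.logq ≤ (M.ell : ℝ) ^ 2) (hh : M.logq ≤ 869 * 10 ^ 12) :
    (1 / 6 - 2 / ((M.ell : ℝ) * ((M.ell : ℝ) + 1))) * M.logq ≤
      (1 + 4 / (M.ell : ℝ)) * M.logDiffLp + 8 * (M.dmod : ℝ) / M.ell * (M.logDiffLtpd + M.logCondLtpd)
        + 4 / (M.ell : ℝ) * Real.log (2 * 3 * 5 * (M.ell : ℝ)) + 80 / 9 * ((M.estar : ℝ) * M.ell + 60) := by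
  have hl5 : (5 : ℝ) ≤ M.ell := M.five_le_ell_real
  have hl : (0 : ℝ) < M.ell := by linarith
  have hq : 0 < M.logq := M.logq_pos
  have hest : (552960 : ℝ) ≤ (M.estar : ℝ) := by
    have h1 : (1 : ℝ) ≤ M.emod := by exact_mod_cast M.one_le_emod
    unfold MainBoundDatum.estar; push_cast; nlinarith
  -- the left side is at most `log q / 6`
  have hLHS : (1 / 6 - 2 / ((M.ell : ℝ) * ((M.ell : ℝ) + 1))) * M.logq ≤ 1 / 6 * M.logq := by
    have h2 : 0 ≤ 2 / ((M.ell : ℝ) * ((M.ell : ℝ) + 1)) := by positivity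
    nlinarith
  -- the three other right-hand terms are `≥ 0`
  have h1 : 0 ≤ (1 + 4 / (M.ell : ℝ)) * M.logDiffLp := mul_nonneg (by positivity) M.logDiffLp_nonneg
  have h2 : 0 ≤ 8 * (M.dmod : ℝ) / M.ell * (M.logDiffLtpd + M.logCondLtpd) :=
    mul_nonneg (by positivity) (add_nonneg M.logDiffLtpd_nonneg M.logCondLtpd_nonneg)
  have h3 : 0 ≤ 4 / (M.ell : ℝ) * Real.log (2 * 3 * 5 * (M.ell : ℝ)) :=
    mul_nonneg (by positivity) (Real.log_nonneg (by linarith))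
  -- the key step: `log q / 6 ≤ (80/9)·552960·ℓ`, by cases on `ℓ ≷ 29491200 = 6·(80/9)·552960`
  have hkey : 1 / 6 * M.logq ≤ 80 / 9 * (552960 * (M.ell : ℝ)) := by
    rcases le_or_gt (29491200 : ℝ) (M.ell : ℝ) with hbig | hsmall
    · linarith
    · have hsq : (M.ell : ℝ) ^ 2 ≤ 29491200 * M.ell := by nlinarith
      linarith
  have h4 : 80 / 9 * (552960 * (M.ell : ℝ)) ≤ 80 / 9 * ((M.estar : ℝ) * M.ell + 60) := by nlinarith
  linarith

set_option maxRecDepth 40000 in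
/-- `30000001` is prime (trial division by `norm_num`; `30000001 − 1 = 2⁷·3·5⁷`). [folklore] -/
theorem prime_30000001 : Nat.Prime 30000001 := by norm_num

/-- **(E) FAILS at an explicit datum INSIDE Lemma 5.8.7's window.** The Thm-6.1.1 datum `ℓ = 30000001` (prime), `d_mod = e_mod = 1`
(`e*_mod = 552960`), all log-degrees `0`, `[L : L_tpd] = [L′ : L] = 1`, `log q = 9·10¹⁴` has `7 ≤ ℓ`, `log q ≤ ℓ²` (the window's lower
end), `ℓ ≤ 10·552960·√(log q)·log(2·552960·log q)` (its upper end at `δ = 552960`, `d = 1`, p.56 l.35–36), and violates (E):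
`(1/6 − 2/(ℓ(ℓ+1)))·9·10¹⁴ > (4/ℓ)·log(30ℓ) + (80/9)·(552960·ℓ + 60)`. A datum over the typed SIGNATURE (nothing of the arithmetic of
any curve); compare p451846's sub-window datum (`ℓ = 5`, `log q = 10⁹`). [claim: Joshi2024ATS4, status: disputed] (locators); [folklore]. -/
theorem exists_window_not_ineqE : ∃ M : MainBoundDatum,
    7 ≤ M.ell ∧ M.logq ≤ (M.ell : ℝ) ^ 2 ∧
    (M.ell : ℝ) ≤ 10 * 552960 * Real.sqrt M.logq * Real.log (2 * 552960 * M.logq) ∧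
    ¬ ((1 / 6 - 2 / ((M.ell : ℝ) * ((M.ell : ℝ) + 1))) * M.logq ≤
      (1 + 4 / (M.ell : ℝ)) * M.logDiffLp + 8 * (M.dmod : ℝ) / M.ell * (M.logDiffLtpd + M.logCondLtpd)
        + 4 / (M.ell : ℝ) * Real.log (2 * 3 * 5 * (M.ell : ℝ)) + 80 / 9 * ((M.estar : ℝ) * M.ell + 60)) := by
  refine ⟨{
      ell := 30000001, ell_prime := prime_30000001, five_le_ell := by norm_num, dmod := 1, one_le_dmod := le_rfl, emod := 1,
      one_le_emod := le_rfl, emod_le_dmod := le_rfl, logq := 9 * 10 ^ 14, logq_pos := by norm_num, logDiffLtpd := 0,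
      logDiffLtpd_nonneg := le_rfl, logCondLtpd := 0, logCondLtpd_nonneg := le_rfl, logDiffL := 0, logDiffL_nonneg := le_rfl,
      logCondL := 0, logCondL_nonneg := le_rfl, logDiffLp := 0, logDiffLp_nonneg := le_rfl, logCondLp := 0,
      logCondLp_nonneg := le_rfl, degLLtpd := 1, one_le_degLLtpd := le_rfl, degLpL := 1, one_le_degLpL := le_rfl }, ?_, ?_, ?_, ?_⟩
  · show 7 ≤ 30000001
    norm_num
  · show (9 * 10 ^ 14 : ℝ) ≤ ((30000001 : ℕ) : ℝ) ^ 2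
    norm_num
  · show ((30000001 : ℕ) : ℝ) ≤ 10 * 552960 * Real.sqrt (9 * 10 ^ 14) * Real.log (2 * 552960 * (9 * 10 ^ 14))
    have hs : Real.sqrt (9 * 10 ^ 14 : ℝ) = 3 * 10 ^ 7 := by
      rw [show (9 * 10 ^ 14 : ℝ) = (3 * 10 ^ 7) ^ 2 by norm_num]
      exact Real.sqrt_sq (by norm_num)
    have hlog : 1 ≤ Real.log (2 * 552960 * (9 * 10 ^ 14 : ℝ)) := by
      rw [← Real.log_exp 1]
      refine Real.log_le_log (Real.exp_pos 1) ?_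
      have := Real.exp_one_lt_d9
      linarith
    rw [hs]
    push_cast
    nlinarith
  · unfold MainBoundDatum.estar
    dsimp only
    push_cast
    have hlog : Real.log (2 * 3 * 5 * (30000001 : ℝ)) ≤ 2 * 3 * 5 * 30000001 := by
      linarith [Real.log_le_sub_one_of_pos (show (0 : ℝ) < 2 * 3 * 5 * 30000001 by norm_num)]
    intro h
    have hl4 : 0 ≤ 4 / (30000001 : ℝ) := by norm_num
    have hb := mul_le_mul_of_nonneg_left hlog hl4
    norm_num at h hb
    linarith

end MainBoundDatum

end Summit.ABC.IUTFork.Joshi.ATS4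

end
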